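import Literature.Computability.Complexity.GateEliminationTransfer
import Literature.Computability.Complexity.GateEliminationOutput
import Literature.Computability.Complexity.GateEliminationXorMap

/-!
# Gate elimination, XI: elimination data, and cascades of Rules 2/3

Seventh layer of the toolkit for the one-step claim `LiYang2022_step` (Li–Yang, STOC 2022; full
version ECCC TR21-023, §3.3 and §4.1, where the case analysis counts "eliminating at least two
gates via Rule 2 and Rule 3", "at least four gates are eliminated by Rule 2 and Rule 3", …).
Everything is PROVED.

* `ElimData C k₀ f R αφ αI αQ 𝒫 δ` — the result of eliminating gate `k₀`: a fair semicircuit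
  computing `f|_R` with a packing, one gate fewer, measure down by `δ`, **together with the
  embedding `ι` of its gates into those of `C` other than `k₀`**, along which gates fed by a
  constant stay fed by a constant (`constFed`) and the readers of a *trivialized* `k₀` become
  fed by a constant (`trivReaders`). Transports `ofSetOut`, `ofFlipGate`; producers
  `elimDataRemoveGate` (Rule 1, `δ = 1 - α_φ · delCost`), `elimDataRedirectConst` (Rule 2 /
  Rule 5-constant), `elimDataBypass` (Rule 3 / Rule 5-affine, `δ = 1 - α_φ`); dispatcher
  **`elimDataConstFed`**: any gate fed by a constant and not reading itself, output or not, under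
  the hypotheses of the one-step claim, with `δ = 1 - α_φ`.
* `constFedCount`, `ElimData.constFedCount_le` (at most the eliminated gate is lost),
  `ElimData.constFedCount_le_of_triv` (readers of a trivialized gate are gained).
* **`cascade`**: if `r` gates are fed by a constant then `r` gates can be eliminated in a row,
  `m' + r = m`, `μ' ≤ μ - r (1 - α_φ)`, staying fair (hence no eliminated gate reads itself,
  `Fair.not_reads_self_of_const`) and computing `f|_R` with a packing.

## References

* J. Li, T. Yang, *3.1n − o(n) circuit lower bounds for explicit functions*, STOC 2022
  [LiYang2022]; full version ECCC TR21-023, §3.3 (Rules 1–5), Lemma 3.11, §4.1 (Cases 1, 3).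
-/

namespace Literature.Computability.Complexity

open Finset

namespace Semicircuit

variable {n : ℕ}

/-- **The data of one gate elimination** at gate `k₀` of `C`: the new fair semicircuit `C'`
computing `f|_R` with a packing, one gate fewer, the measure decreased by at least `δ`, together
with the embedding `ι` of its gates into the gates of `C` other than `k₀`, along which gates fed
by a constant stay fed by a constant, and the readers of `k₀` become fed by a constant whenever
`k₀` was trivialized (fed by a constant with a constant live function). This is the bookkeeping
needed to chain normalization steps (Li–Yang §3.3, §4.1: "eliminating at least two gates via
Rule 2 and Rule 3", "at least four gates are eliminated by Rule 2 and Rule 3").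
[cite: LiYang2022, §3.3, Lemma 3.11] -/
structure ElimData (C : Semicircuit n) (k₀ : Fin C.m) (f : (Fin n → ZMod 2) → Bool) (R : RdqSource n)
    (αφ αI αQ : ℝ) (P : Finset (Fin C.m × Fin C.m)) (δ : ℝ) where
  /-- the new circuit -/
  C' : Semicircuit n
  /-- its packing -/
  P' : Finset (Fin C'.m × Fin C'.m)
  /-- it is fair -/
  fair : C'.Fair
  /-- it computes `f|_R` -/
  computes : C'.ComputesRestr f R
  /-- `P'` is a packing -/
  packing : C'.IsPacking P'
  /-- one gate fewer -/
  m_add_one : C'.m + 1 = C.m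
  /-- the measure dropped by `δ` -/
  measure_le : C'.measure αφ αI αQ P' R ≤ C.measure αφ αI αQ P R - δ
  /-- the embedding of the gates of `C'` into those of `C` -/
  ι : Fin C'.m → Fin C.m
  /-- it is injective -/
  ι_injective : Function.Injective ι
  /-- it misses `k₀` -/
  ι_ne : ∀ k', ι k' ≠ k₀
  /-- it hits every other gate -/
  ι_surj : ∀ k, k ≠ k₀ → ∃ k', ι k' = k
  /-- gates fed by a constant stay fed by a constant -/
  constFed : ∀ k', (∃ a b, C.arg (ι k') a = .const b) → ∃ a b, C'.arg k' a = .const b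
  /-- if `k₀` is trivialized, its readers become fed by a constant -/
  trivReaders : (∃ a₀ b, C.arg k₀ a₀ = .const b ∧ C.liveFn k₀ a₀ b false = C.liveFn k₀ a₀ b true) →
    ∀ k', (∃ a, C.arg (ι k') a = .gate k₀) → ∃ a b, C'.arg k' a = .const b

namespace ElimData

variable {C : Semicircuit n} {k₀ : Fin C.m} {f : (Fin n → ZMod 2) → Bool} {R : RdqSource n}
  {αφ αI αQ : ℝ} {P : Finset (Fin C.m × Fin C.m)} {δ δ' : ℝ}

/-- Weakening the measure bound. [folklore] -/
def mono (E : ElimData C k₀ f R αφ αI αQ P δ) (h : δ' ≤ δ) : ElimData C k₀ f R αφ αI αQ P δ' :=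
  { E with measure_le := E.measure_le.trans (by linarith) }

/-- Transport along `setOut` (same gates, wires, functions, measure). [folklore] -/
def ofSetOut {v : Node n C.m} (E : ElimData (C.setOut v) k₀ f R αφ αI αQ P δ) : ElimData C k₀ f R αφ αI αQ P δ :=
  { C' := E.C', P' := E.P', fair := E.fair, computes := E.computes, packing := E.packing,
    m_add_one := E.m_add_one, measure_le := (C.measure_setOut v αφ αI αQ P R) ▸ E.measure_le,
    ι := E.ι, ι_injective := E.ι_injective, ι_ne := E.ι_ne, ι_surj := E.ι_surj,
    constFed := E.constFed, trivReaders := E.trivReaders }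

/-- The live function of `k₀` after flipping `k₁ ≠ k₀`: the live input is negated iff it is
`k₁`. [folklore] -/
theorem _root_.Literature.Computability.Complexity.Semicircuit.liveFn_flipGate (C : Semicircuit n)
    {k₀ k₁ : Fin C.m} (hk : k₀ ≠ k₁) {a₀ : Fin 2} {b : Bool} (h₀ : C.arg k₀ a₀ = .const b) (t : Bool) :
    (C.flipGate k₁).liveFn k₀ a₀ b t = C.liveFn k₀ a₀ b (t ^^ decide (C.arg k₀ a₀.rev = .gate k₁)) := by
  unfold liveFn
  show (if a₀ = 0 then (if k₀ = k₁ then _ else _) else (if k₀ = k₁ then _ else _)) = _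
  simp only [hk, if_false]
  obtain rfl | rfl : a₀ = 0 ∨ a₀ = 1 := by fin_cases a₀ <;> simp
  · have hr : (0 : Fin 2).rev = 1 := rfl
    have hd : decide (C.arg k₀ 0 = Node.gate k₁) = false := decide_eq_false (by rw [h₀]; exact fun h => by cases h)
    rw [if_pos rfl, if_pos rfl, hd, Bool.xor_false, hr]
  · have hr : (1 : Fin 2).rev = 0 := rfl
    have hd : decide (C.arg k₀ 1 = Node.gate k₁) = false := decide_eq_false (by rw [h₀]; exact fun h => by cases h)
    rw [if_neg (by decide), if_neg (by decide), hd, Bool.xor_false, hr]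

/-- Transport along `flipGate k₁` for `k₁ ≠ k₀` (same gates and wires, same measure; the live
function of `k₀` is precomposed with a negation at most, so being trivialized is unchanged).
[folklore] -/
def ofFlipGate {k₁ : Fin C.m} (E : ElimData (C.flipGate k₁) k₀ f R αφ αI αQ P δ) (hk : k₀ ≠ k₁) :
    ElimData C k₀ f R αφ αI αQ P δ :=
  { C' := E.C', P' := E.P', fair := E.fair, computes := E.computes, packing := E.packing,
    m_add_one := E.m_add_one, measure_le := (C.measure_flipGate k₁ αφ αI αQ P R) ▸ E.measure_le,
    ι := E.ι, ι_injective := E.ι_injective, ι_ne := E.ι_ne, ι_surj := E.ι_surj,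
    constFed := E.constFed,
    trivReaders := fun ⟨a₀, b, h₀, htriv⟩ => E.trivReaders ⟨a₀, b, h₀, by
      rw [C.liveFn_flipGate hk h₀, C.liveFn_flipGate hk h₀]
      by_cases hs : C.arg k₀ a₀.rev = .gate k₁
      · rw [decide_eq_true hs]; exact htriv.symm
      · rw [decide_eq_false hs]; exact htriv⟩ }

end ElimData


/-! ### Producing elimination data from the three constructions -/

section Producers

variable (C : Semicircuit n) (k₀ : Fin C.m) {f : (Fin n → ZMod 2) → Bool} {R : RdqSource n}
  {αφ αI : ℝ}

/-- The accounting constant of a deleted gate: `1` if its wires coincide or one is a constant,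
`2` otherwise. [cite: LiYang2022, §3.3] -/
noncomputable def delCost (D : Semicircuit n) (k : Fin D.m) : ℝ :=
  if D.arg k 0 = D.arg k 1 ∨ (∃ b, D.arg k 0 = .const b) ∨ (∃ b, D.arg k 1 = .const b) then 1 else 2

/-- The accounting constant is `1` for a gate fed by a constant. [folklore] -/
theorem delCost_of_const (D : Semicircuit n) (k : Fin D.m) {a : Fin 2} {b : Bool} (h : D.arg k a = .const b) :
    D.delCost k = 1 := by
  unfold delCost
  rw [if_pos]
  obtain rfl | rfl : a = 0 ∨ a = 1 := by fin_cases a <;> simp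
  · exact Or.inr (Or.inl ⟨b, h⟩)
  · exact Or.inr (Or.inr ⟨b, h⟩)

/-- The accounting constant is at most `2`. [folklore] -/
theorem delCost_le_two (D : Semicircuit n) (k : Fin D.m) : D.delCost k ≤ 2 := by
  unfold delCost; split_ifs <;> norm_num

/-- The accounting constant is at least `1`. [folklore] -/
theorem one_le_delCost (D : Semicircuit n) (k : Fin D.m) : 1 ≤ D.delCost k := by
  unfold delCost; split_ifs <;> norm_num

variable {C k₀}

/-- **Elimination data from deleting an unread gate** (Rule 1). [cite: LiYang2022, Lemma 3.11 (Rule 1)] -/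
noncomputable def elimDataRemoveGate (hF : C.Fair) (hC : C.ComputesRestr f R)
    {P : Finset (Fin C.m × Fin C.m)} (hP : C.IsPacking P)
    (h0 : ∀ k a, C.arg k a ≠ .gate k₀) (hout : C.out ≠ .gate k₀) (hφ : 0 ≤ αφ) (hI : 0 ≤ αI) (αQ : ℝ) :
    ElimData C k₀ f R αφ αI αQ P (1 - αφ * C.delCost k₀) := by
  let ε := C.skipEquiv k₀
  have hex := C.exists_packing_removeGate_le k₀ ε h0 hP
  refine
    { C' := C.removeGate k₀ ε, P' := Classical.choose hex, fair := hF.removeGate ε h0,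
      computes := hC.removeGate ε hF h0 hout, packing := (Classical.choose_spec hex).1,
      m_add_one := C.removeGate_m_add_one k₀ ε, measure_le := ?_,
      ι := fun k => (ε k : Fin C.m), ι_injective := fun k k' h => ε.injective (Subtype.ext h),
      ι_ne := fun k => (ε k).2, ι_surj := fun k hk => ⟨ε.symm ⟨k, hk⟩, by simp⟩,
      constFed := fun k' ⟨a, b, h⟩ => ⟨a, b, by rw [removeGate_arg, h]; rfl⟩,
      trivReaders := fun _ k' ⟨a, h⟩ => absurd h (h0 _ a) }
  have hpot : (C.removeGate k₀ ε).potential (Classical.choose hex) ≤ C.potential P + C.delCost k₀ :=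
    (Classical.choose_spec hex).2
  have hinf : (((C.removeGate k₀ ε).influential R).card : ℝ) ≤ (C.influential R).card := by
    exact_mod_cast card_le_card (C.influential_removeGate_subset k₀ ε h0 R)
  have hm : (((C.m - 1 : ℕ)) : ℝ) + 1 = C.m := by exact_mod_cast C.removeGate_m_add_one k₀ ε
  unfold measure
  show ((C.m - 1 : ℕ) : ℝ) + _ + _ + _ ≤ _
  nlinarith [mul_le_mul_of_nonneg_left hinf hI, mul_le_mul_of_nonneg_left hpot hφ]

/-- **Elimination data from redirecting to a constant and deleting** (Rule 2, and Rule 5 for a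
constant live function): the readers of `k₀` become fed by the constant. [cite: LiYang2022, Lemma 3.11 (Rules 2, 5)] -/
noncomputable def elimDataRedirectConst (hF : C.Fair) (hC : C.ComputesRestr f R)
    {P : Finset (Fin C.m × Fin C.m)} (hP : C.IsPacking P) (c : Bool) (hk₀ : ¬ C.Troubled k₀)
    (hself : ∀ a, C.arg k₀ a ≠ .gate k₀)
    (hid : ∀ (x : Fin n → Bool) (w : Fin C.m → Bool),
      C.op k₀ (C.nodeVal x w (C.arg k₀ 0)) (C.nodeVal x w (C.arg k₀ 1)) = (C.nodeVal x w (.const c) ^^ false))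
    (hout : C.out ≠ .gate k₀) (hφ : 0 ≤ αφ) (hI : 0 ≤ αI) (αQ : ℝ) :
    ElimData C k₀ f R αφ αI αQ P (1 - αφ * C.delCost k₀) := by
  have hv := C.redirectOK_const k₀ c
  let C₁ := C.redirect k₀ (.const c) false hv
  have hF₁ : C₁.Fair := hF.redirect hself hid
  have hC₁ : C₁.ComputesRestr f R := hC.redirect hself hid (fun i h => by cases h)
  obtain ⟨hP₁, hμ₁⟩ := C.measure_redirect_const' k₀ hk₀ c false αφ αI αQ hP R
  have h0₁ : ∀ k a, C₁.arg k a ≠ .gate k₀ :=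
    (fanout_eq_zero_iff _ _).mp (C.fanout_redirect_self k₀ _ false hv (fun h => by cases h))
  have hargs₁ : ∀ a, C₁.arg k₀ a = C.arg k₀ a := fun a => by
    show (if C.arg k₀ a = .gate k₀ then Node.const c else C.arg k₀ a) = _; rw [if_neg (hself a)]
  have hcost : C₁.delCost k₀ = C.delCost k₀ := by
    unfold delCost; rw [hargs₁ 0, hargs₁ 1]
  let E := (elimDataRemoveGate (C := C₁) (k₀ := k₀) hF₁ hC₁ hP₁ h0₁ hout hφ hI αQ).mono
    (δ' := 1 - αφ * C.delCost k₀) (by rw [hcost])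
  exact
    { C' := E.C', P' := E.P', fair := E.fair, computes := E.computes, packing := E.packing,
      m_add_one := E.m_add_one,
      measure_le := by have := E.measure_le; linarith,
      ι := E.ι, ι_injective := E.ι_injective, ι_ne := E.ι_ne, ι_surj := E.ι_surj,
      constFed := fun k' ⟨a, b, h⟩ => E.constFed k' ⟨a, b, by
        show (if C.arg (E.ι k') a = .gate k₀ then Node.const c else C.arg (E.ι k') a) = .const b
        rw [h, if_neg (fun h' => by cases h')]⟩,
      trivReaders := fun _ k' ⟨a, h⟩ => E.constFed k' ⟨a, c, by
        show (if C.arg (E.ι k') a = .gate k₀ then Node.const c else C.arg (E.ι k') a) = .const c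
        rw [if_pos h]⟩ }

/-- **Elimination data from bypassing** (Rule 3, and Rule 5 for an affine live function), when
the other wire of `k₀` is a constant or coincides with the target (`ΔΦ ≤ 1`).
[cite: LiYang2022, Lemma 3.11 (Rules 3, 5)] -/
noncomputable def elimDataBypass (a₀ : Fin 2) (neg : Bool) (hF : C.Fair) (hC : C.ComputesRestr f R)
    {P : Finset (Fin C.m × Fin C.m)} (hP : C.IsPacking P) (hk₀ : ¬ C.Troubled k₀)
    (hself : ∀ a, C.arg k₀ a ≠ .gate k₀)
    (hid : ∀ (x : Fin n → Bool) (w : Fin C.m → Bool),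
      C.op k₀ (C.nodeVal x w (C.arg k₀ 0)) (C.nodeVal x w (C.arg k₀ 1)) = (C.nodeVal x w (C.arg k₀ a₀.rev) ^^ neg))
    (hacc : C.arg k₀ a₀ = C.arg k₀ a₀.rev ∨ ∃ b, C.arg k₀ a₀ = .const b)
    (hout : C.out ≠ .gate k₀) (hφ : 0 ≤ αφ) (hI : 0 ≤ αI) (αQ : ℝ) :
    ElimData C k₀ f R αφ αI αQ P (1 - αφ) := by
  have hv := C.redirectOK_live k₀ a₀
  have hlive : C.arg k₀ a₀.rev ≠ .gate k₀ := hself _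
  let C₁ := C.redirect k₀ (C.arg k₀ a₀.rev) neg hv
  have hF₁ : C₁.Fair := hF.redirect hself hid
  have hC₁ : C₁.ComputesRestr f R := hC.redirect hself hid fun i h => ⟨_, h⟩
  have h0₁ : ∀ k a, C₁.arg k a ≠ .gate k₀ := C.not_reads_redirect_live neg hlive
  let ε := C.skipEquiv k₀
  have hex := C.exists_packing_bypass_le k₀ a₀ neg ε hself hk₀ hP
  -- the target is a constant whenever `k₀` is trivialized at some constant position
  have hvconst : (∃ a₁ b, C.arg k₀ a₁ = .const b ∧ C.liveFn k₀ a₁ b false = C.liveFn k₀ a₁ b true) →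
      ∃ b, C.arg k₀ a₀.rev = .const b := by
    rintro ⟨a₁, b, h₁, htriv⟩
    by_cases ha : a₁ = a₀
    · subst ha
      -- `liveFn` at the live input is constant, but equals the live input up to `neg`
      have key : ∀ (x : Fin n → Bool) (w : Fin C.m → Bool),
          (C.nodeVal x w (C.arg k₀ a₁.rev) ^^ neg) = C.liveFn k₀ a₁ b false := by
        intro x w
        rw [← hid x w, op_eq_liveFn h₁]
        cases C.nodeVal x w (C.arg k₀ a₁.rev)
        · rfl
        · exact htriv.symm
      cases hw : C.arg k₀ a₁.rev with
      | const b' => exact ⟨b', rfl⟩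
      | var i =>
        exfalso
        have h1 := key (fun _ => false) (fun _ => false)
        have h2 := key (fun _ => true) (fun _ => false)
        rw [hw] at h1 h2
        change (false ^^ neg) = _ at h1
        change (true ^^ neg) = _ at h2
        rw [← h2] at h1
        cases neg <;> simp at h1
      | gate k =>
        exfalso
        have h1 := key (fun _ => false) (fun _ => false)
        have h2 := key (fun _ => false) (fun _ => true)
        rw [hw] at h1 h2
        change (false ^^ neg) = _ at h1
        change (true ^^ neg) = _ at h2
        rw [← h2] at h1
        cases neg <;> simp at h1
    · have : a₁ = a₀.rev := by
        obtain rfl | rfl : a₀ = 0 ∨ a₀ = 1 := by fin_cases a₀ <;> simp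
        all_goals obtain rfl | rfl : a₁ = 0 ∨ a₁ = 1 := by fin_cases a₁ <;> simp
        all_goals first | exact absurd rfl ha | rfl
      exact ⟨b, this ▸ h₁⟩
  refine
    { C' := C.bypass k₀ a₀ neg ε, P' := Classical.choose hex, fair := Fair.removeGate (C := C₁) ε hF₁ h0₁,
      computes := ComputesRestr.removeGate (C := C₁) ε hC₁ hF₁ h0₁ hout, packing := (Classical.choose_spec hex).1,
      m_add_one := C₁.removeGate_m_add_one k₀ ε, measure_le := ?_,
      ι := fun k => (ε k : Fin C.m), ι_injective := fun k k' h => ε.injective (Subtype.ext h),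
      ι_ne := fun k => (ε k).2, ι_surj := fun k hk => ⟨ε.symm ⟨k, hk⟩, by simp⟩,
      constFed := fun k' ⟨a, b, h⟩ => ⟨a, b, by rw [bypass_arg, h, if_neg (fun h' => by cases h')]; rfl⟩,
      trivReaders := fun htr k' ⟨a, h⟩ => ?_ }
  · have hle : (if C.arg k₀ a₀ = C.arg k₀ a₀.rev ∨ ∃ b, C.arg k₀ a₀ = .const b then (1 : ℝ) else 2) = 1 :=
      if_pos hacc
    have hpot : (C.bypass k₀ a₀ neg ε).potential (Classical.choose hex) ≤ C.potential P + 1 := by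
      have := (Classical.choose_spec hex).2
      linarith
    have hinf : (((C.bypass k₀ a₀ neg ε).influential R).card : ℝ) ≤ (C.influential R).card := by
      exact_mod_cast card_le_card (C.influential_bypass_subset' k₀ a₀ neg ε hself R)
    have hm : (((C.m - 1 : ℕ)) : ℝ) + 1 = C.m := by exact_mod_cast C₁.removeGate_m_add_one k₀ ε
    unfold measure
    show ((C.m - 1 : ℕ) : ℝ) + _ + _ + _ ≤ _
    nlinarith [mul_le_mul_of_nonneg_left hinf hI, mul_le_mul_of_nonneg_left hpot hφ]
  · obtain ⟨b, hb⟩ := hvconst htr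
    exact ⟨a, b, by rw [bypass_arg, if_pos h, hb]; rfl⟩

/-! ### Dispatching: any gate fed by a constant; any gate with coinciding wires -/

variable {d : ℕ}

/-- **Elimination data for a gate fed by a constant** (Rules 2/3, output or not), under the
hypotheses of the one-step claim; `Δμ ≥ 1 - α_φ`. [cite: LiYang2022, Lemma 3.11 (Rules 2, 3)] -/
noncomputable def elimDataConstFed (hf : IsAffineDisperser f d) (hd : 2 * d + 2 ≤ R.dim) (hF : C.Fair)
    (hC : C.ComputesRestr f R) {P : Finset (Fin C.m × Fin C.m)} (hP : C.IsPacking P)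
    {a₀ : Fin 2} {b : Bool} (h₀ : C.arg k₀ a₀ = .const b) (hself : ∀ a, C.arg k₀ a ≠ .gate k₀)
    (hφ : 0 ≤ αφ) (hI : 0 ≤ αI) (αQ : ℝ) : ElimData C k₀ f R αφ αI αQ P (1 - αφ) := by
  have hk₀ : ¬ C.Troubled k₀ := not_troubled_of_reads_const h₀
  by_cases htriv : C.liveFn k₀ a₀ b false = C.liveFn k₀ a₀ b true
  · -- trivialized: not the output; readers read the constant
    have hout : C.out ≠ .gate k₀ := out_ne_of_trivialized hf (by omega) hF hC h₀ htriv
    have hid : ∀ (x : Fin n → Bool) (w : Fin C.m → Bool),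
        C.op k₀ (C.nodeVal x w (C.arg k₀ 0)) (C.nodeVal x w (C.arg k₀ 1)) =
          (C.nodeVal x w (.const (C.liveFn k₀ a₀ b false)) ^^ false) := by
      intro x w
      rw [op_eq_liveFn h₀, Bool.xor_false]
      show _ = C.liveFn k₀ a₀ b false
      cases C.nodeVal x w (C.arg k₀ a₀.rev)
      · rfl
      · exact htriv.symm
    exact (elimDataRedirectConst hF hC hP _ hk₀ hself hid hout hφ hI αQ).mono
      (by rw [C.delCost_of_const k₀ h₀, mul_one])
  · -- degenerate
    have hdeg : ∀ t, C.liveFn k₀ a₀ b t = (t ^^ C.liveFn k₀ a₀ b false) :=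
      (bool_fn_const_or_xor _).resolve_left htriv
    have hid : ∀ (x : Fin n → Bool) (w : Fin C.m → Bool),
        C.op k₀ (C.nodeVal x w (C.arg k₀ 0)) (C.nodeVal x w (C.arg k₀ 1)) =
          (C.nodeVal x w (C.arg k₀ a₀.rev) ^^ C.liveFn k₀ a₀ b false) := by
      intro x w; rw [op_eq_liveFn h₀, hdeg]
    by_cases hout : C.out = .gate k₀
    · -- the output gate: its live input is a gate `k₁`
      cases hk₁ : C.arg k₀ a₀.rev with
      | const b' => exact absurd hout (out_ne_of_const_const hf (by omega) hF hC h₀ hk₁)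
      | var i => exact absurd hout (out_ne_of_live_var hf hd hF hC h₀ hk₁)
      | gate k₁ =>
      have hk : k₀ ≠ k₁ := fun h => hself a₀.rev (by rw [hk₁, h])
      cases hneg : C.liveFn k₀ a₀ b false with
      | false =>
        -- pass-through: move the output to `k₁`, then bypass
        rw [hneg] at hid
        have hval : ∀ (x : Fin n → Bool) (w : Fin C.m → Bool), C.Consistent x w →
            C.nodeVal x w (C.arg k₀ a₀.rev) = C.nodeVal x w C.out := by
          intro x w hw
          rw [hout]
          show _ = w k₀
          rw [hw k₀, hid, Bool.xor_false]
        have hid' : ∀ (x : Fin n → Bool) (w : Fin C.m → Bool),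
            (C.setOut (C.arg k₀ a₀.rev)).op k₀ ((C.setOut (C.arg k₀ a₀.rev)).nodeVal x w (C.arg k₀ 0))
              ((C.setOut (C.arg k₀ a₀.rev)).nodeVal x w (C.arg k₀ 1)) =
              ((C.setOut (C.arg k₀ a₀.rev)).nodeVal x w (C.arg k₀ a₀.rev) ^^ false) := by
          intro x w
          simp only [nodeVal_setOut_eq]
          exact hid x w
        refine ElimData.ofSetOut (v := C.arg k₀ a₀.rev)
          (elimDataBypass (C := C.setOut (C.arg k₀ a₀.rev)) (k₀ := k₀) a₀ false hF.setOut (hC.setOut hval)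
            ((C.isPacking_setOut_iff _ P).mpr hP) hk₀ hself hid' (Or.inr ⟨b, h₀⟩) (hself a₀.rev) hφ hI αQ)
      | true =>
        -- negated: flip `k₁`, move the output to `k₁`, then bypass
        rw [hneg] at hid
        let C₂ := C.flipGate k₁
        have hF₂ : C₂.Fair := hF.flipGate
        have hC₂ : C₂.ComputesRestr f R := hC.flipGate (by rw [hout]; exact fun h => hk (Node.gate.inj h))
        have hP₂ : C₂.IsPacking P := (C.isPacking_flipGate_iff k₁ P).mpr hP
        have hid₂ : ∀ (x : Fin n → Bool) (w : Fin C.m → Bool),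
            C₂.op k₀ (C₂.nodeVal x w (C₂.arg k₀ 0)) (C₂.nodeVal x w (C₂.arg k₀ 1)) =
              (C₂.nodeVal x w (C₂.arg k₀ a₀.rev) ^^ false) := by
          intro x w
          rw [op_eq_liveFn (C := C₂) h₀, C.liveFn_flipGate hk h₀, hk₁, decide_eq_true rfl, hdeg, hneg,
            Bool.xor_false]
          show ((C.nodeVal x w (.gate k₁) ^^ true) ^^ true) = C.nodeVal x w (.gate k₁)
          cases C.nodeVal x w (.gate k₁) <;> rfl
        have hval : ∀ (x : Fin n → Bool) (w : Fin C.m → Bool), C₂.Consistent x w →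
            C₂.nodeVal x w (C₂.arg k₀ a₀.rev) = C₂.nodeVal x w C₂.out := by
          intro x w hw
          show C₂.nodeVal x w (C.arg k₀ a₀.rev) = C₂.nodeVal x w C.out
          rw [hout]
          show _ = w k₀
          rw [hw k₀, hid₂, Bool.xor_false]
        have hk₀₂ : ¬ C₂.Troubled k₀ := fun h => hk₀ ((C.troubled_flipGate_iff k₁ k₀).mp h)
        have hid₂' : ∀ (x : Fin n → Bool) (w : Fin C.m → Bool),
            (C₂.setOut (C.arg k₀ a₀.rev)).op k₀ ((C₂.setOut (C.arg k₀ a₀.rev)).nodeVal x w (C.arg k₀ 0))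
              ((C₂.setOut (C.arg k₀ a₀.rev)).nodeVal x w (C.arg k₀ 1)) =
              ((C₂.setOut (C.arg k₀ a₀.rev)).nodeVal x w (C.arg k₀ a₀.rev) ^^ false) := by
          intro x w
          simp only [nodeVal_setOut_eq]
          exact hid₂ x w
        refine ElimData.ofFlipGate (k₁ := k₁) (ElimData.ofSetOut (v := C.arg k₀ a₀.rev)
          (elimDataBypass (C := C₂.setOut (C.arg k₀ a₀.rev)) (k₀ := k₀) a₀ false hF₂.setOut (hC₂.setOut hval)
            ((C₂.isPacking_setOut_iff _ P).mpr hP₂) hk₀₂ hself hid₂' (Or.inr ⟨b, h₀⟩) (hself a₀.rev) hφ hI αQ)) hk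
    · exact elimDataBypass a₀ _ hF hC hP hk₀ hself hid (Or.inr ⟨b, h₀⟩) hout hφ hI αQ

/-! ### Counting gates fed by a constant; cascades -/

/-- The number of gates with a constant wire. [cite: LiYang2022, §3.3] -/
noncomputable def constFedCount (D : Semicircuit n) : ℕ :=
  (univ.filter fun k => ∃ a b, D.arg k a = .const b).card

/-- **Along an elimination, at most one gate fed by a constant is lost** (the eliminated one;
the others stay fed by a constant). [cite: LiYang2022, §3.3] -/
theorem ElimData.constFedCount_le {P : Finset (Fin C.m × Fin C.m)} {αQ δ : ℝ}
    (E : ElimData C k₀ f R αφ αI αQ P δ) : C.constFedCount ≤ E.C'.constFedCount + 1 := by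
  classical
  unfold constFedCount
  set S := univ.filter fun k => ∃ a b, C.arg k a = .const b with hS
  set S' := univ.filter fun k' => ∃ a b, E.C'.arg k' a = .const b with hS'
  have hsub : S.erase k₀ ⊆ S'.image E.ι := by
    intro k hk
    rw [mem_erase] at hk
    obtain ⟨k', rfl⟩ := E.ι_surj k hk.1
    refine mem_image.mpr ⟨k', ?_, rfl⟩
    rw [hS', mem_filter]
    exact ⟨mem_univ _, E.constFed k' (by simpa [hS] using hk.2)⟩
  have h1 := card_le_card hsub
  have h2 : (S'.image E.ι).card ≤ S'.card := card_image_le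
  have h3 := card_erase_add_one (s := S) (a := k₀)
  by_cases hk : k₀ ∈ S
  · rw [card_erase_of_mem hk] at h1
    have := card_pos.mpr ⟨k₀, hk⟩
    omega
  · rw [erase_eq_of_notMem hk] at h1
    omega

/-- **Readers of a trivialized gate become fed by a constant**: a lower bound for the count
after eliminating a trivialized `k₀` in terms of its readers that were not yet fed by a
constant. [cite: LiYang2022, §3.3 (Rule 2)] -/
theorem ElimData.constFedCount_le_of_triv {P : Finset (Fin C.m × Fin C.m)} {αQ δ : ℝ}
    (E : ElimData C k₀ f R αφ αI αQ P δ)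
    (htriv : ∃ a₀ b, C.arg k₀ a₀ = .const b ∧ C.liveFn k₀ a₀ b false = C.liveFn k₀ a₀ b true) :
    (univ.filter fun k => k ≠ k₀ ∧ ((∃ a b, C.arg k a = .const b) ∨ ∃ a, C.arg k a = .gate k₀)).card ≤
      E.C'.constFedCount := by
  classical
  unfold constFedCount
  set S' := univ.filter fun k' => ∃ a b, E.C'.arg k' a = .const b with hS'
  refine le_trans (card_le_card (t := S'.image E.ι) fun k hk => ?_) card_image_le
  rw [mem_filter] at hk
  obtain ⟨-, hk0, hk⟩ := hk
  obtain ⟨k', rfl⟩ := E.ι_surj k hk0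
  refine mem_image.mpr ⟨k', ?_, rfl⟩
  rw [hS', mem_filter]
  refine ⟨mem_univ _, ?_⟩
  rcases hk with hk | hk
  · exact E.constFed k' hk
  · exact E.trivReaders htriv k' hk

/-- **Cascade of Rules 2/3** (Li–Yang's "eliminating at least `r` gates via Rule 2 and Rule 3"):
under the hypotheses of the one-step claim, if at least `r` gates are fed by a constant, then
`r` gates can be eliminated one after the other, each with `Δμ ≥ 1 - α_φ`, keeping fairness,
`f|_R` and a packing (the circuit stays fair, so no eliminated gate reads itself,
`Fair.not_reads_self_of_const`). [cite: LiYang2022, §3.3, Lemma 3.11, §4.1] -/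
theorem cascade (hf : IsAffineDisperser f d) (hd : 2 * d + 2 ≤ R.dim) (hφ : 0 ≤ αφ) (hI : 0 ≤ αI) (αQ : ℝ) :
    ∀ (r : ℕ) (D : Semicircuit n) (P : Finset (Fin D.m × Fin D.m)), D.Fair → D.ComputesRestr f R →
      D.IsPacking P → r ≤ D.constFedCount →
      ∃ (D' : Semicircuit n) (P' : Finset (Fin D'.m × Fin D'.m)), D'.Fair ∧ D'.ComputesRestr f R ∧
        D'.IsPacking P' ∧ D'.m + r = D.m ∧
        D'.measure αφ αI αQ P' R ≤ D.measure αφ αI αQ P R - r * (1 - αφ) := by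
  classical
  intro r
  induction r with
  | zero =>
    intro D P hF hC hP _
    exact ⟨D, P, hF, hC, hP, by simp, by simp⟩
  | succ r ih =>
    intro D P hF hC hP hr
    -- pick a gate fed by a constant
    have hne : (univ.filter fun k => ∃ a b, D.arg k a = .const b).Nonempty := by
      rw [← card_pos]; unfold constFedCount at hr; omega
    obtain ⟨k₀, hk₀⟩ := hne
    obtain ⟨a₀, b, h₀⟩ := (mem_filter.mp hk₀).2
    have hself := hF.not_reads_self_of_const h₀
    let E := elimDataConstFed (C := D) (k₀ := k₀) hf hd hF hC hP h₀ hself hφ hI αQ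
    have hcount : r ≤ E.C'.constFedCount := by
      have := E.constFedCount_le; omega
    obtain ⟨D', P', hF', hC', hP', hm, hμ⟩ := ih E.C' E.P' E.fair E.computes E.packing hcount
    refine ⟨D', P', hF', hC', hP', ?_, ?_⟩
    · have := E.m_add_one; omega
    · have := E.measure_le
      push_cast
      linarith

end Producers
end Semicircuit

end Literature.Computability.Complexity
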